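import Mathlib.GroupTheory.Index
import Mathlib.Data.Fintype.Powerset
import Mathlib.Data.Finset.Max
import Mathlib.Algebra.Order.BigOperators.Group.Finset
import Mathlib.Tactic.Group
import Mathlib.Tactic.Linarith
import HarnessLib

/-!
# Right transversals with trivial left stabiliser: a transversal avoiding one of its own right translates

COR-CM (cell `pub-hodgecm2`), binder seat b04 (gen 19), count-neutral claim GALOIS-TWICE-ODD, part I (pure group
theory, Mathlib only).  KERNEL ONLY: theorems; no definition, no named fact, no `sorry`.  `HC_CM` is neither used
nor claimed.

SETTING.  `V ≤ H` subgroups of a group `G`, `V` with at least three elements, and `y₀ ∈ H ∖ V` with `y₀² ≠ 1`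
(automatic when `H` is finite of odd order and `V ≠ 1`).  A finite set `N ⊆ H` is an *admissible partial
transversal* when `1, y₀ ∈ N`, `N` meets every right coset `V z` at most once, and

  `n ∈ N`, `n ≠ 1` ⟹ `n · y₀ ∉ N`.                                                            (†)

* §1 **`exists_insert_of_forall_not_mem`** (the extension step): if the right coset `V z ⊆ H` misses an admissible
  `N`, some `x ∈ V z` keeps `N ∪ {x}` admissible — among three elements of `V z` at most one has `x y₀ ∈ N` and at
  most one is of the form `n y₀` (`n ∈ N`), because `N` and `N y₀` meet each right coset at most once.
* §2 **`exists_transversal_avoiding`** / **`exists_transversal`**: hence (a maximal admissible set) a full right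
  transversal `N ∋ 1` of `V` in `H` with (†); and (†) with `1, y₀ ∈ N` forces the LEFT STABILISER of `N` to be
  trivial (`eq_one_of_forall_mul_mem`: `uN ⊆ N` ⟹ `u = u·1 ∈ N` and `u·y₀ ∈ N` ⟹ `u = 1`).
* §3 `card_mul_card_eq` (double counting): `|N| · |V| = |H|` for a right transversal `N ⊆ H`.

This is the combinatorial input of the claim: for a Galois CM field `K ⊇ k` (imaginary quadratic) with
`H = Gal(K/k)`, the CM type `N ∪ c(H ∖ N)` read on `Gal(K/ℚ) = ⟨c⟩ × H` is PRIMITIVE (trivial stabiliser) and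
DEGENERATE (parts II–IV).

## References

* [Shimura1998] G. Shimura, *Abelian Varieties with Complex Multiplication and Modular Functions*, §8.2 Prop. 26
  (primitive types ⟷ trivial stabilisers).
* [Dodson1984] B. Dodson, *The structure of Galois groups of CM-fields*, Trans. AMS 283 (1984), §3.1.1 (types on
  `⟨ρ⟩ × G₀` for a CM field with an imaginary quadratic subfield).
-/

namespace Summit.HodgeConjecture.CorCM.TwiceOdd

open scoped Classical

variable {G : Type*} [Group G]

/-! ## §1 Partial transversals and the extension step -/

section Step

variable {V H : Subgroup G} {y₀ : G} {N : Finset G}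

/-- Two elements of one right coset of `V` whose right `y₀`-translates both lie in a set meeting every right coset
of `V` at most once are equal. [folklore] -/
theorem eq_of_mul_mem_of_mul_mem (hNd : ∀ n ∈ N, ∀ n' ∈ N, n * n'⁻¹ ∈ V → n = n') {x x' : G}
    (hxx' : x * x'⁻¹ ∈ V) (hx : x * y₀ ∈ N) (hx' : x' * y₀ ∈ N) : x = x' := by
  have h1 : x * y₀ * (x' * y₀)⁻¹ = x * x'⁻¹ := by group
  have h2 := hNd _ hx _ hx' (by rw [h1]; exact hxx')
  exact mul_right_cancel h2

/-- Two elements of one right coset of `V` which are both right `y₀`-translates of elements of a set meeting every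
right coset of `V` at most once are equal. [folklore] -/
theorem eq_of_eq_mul_of_eq_mul (hNd : ∀ n ∈ N, ∀ n' ∈ N, n * n'⁻¹ ∈ V → n = n') {x x' n n' : G}
    (hxx' : x * x'⁻¹ ∈ V) (hn : n ∈ N) (hn' : n' ∈ N) (hx : n * y₀ = x) (hx' : n' * y₀ = x') : x = x' := by
  subst hx hx'
  have h1 : n * y₀ * (n' * y₀)⁻¹ = n * n'⁻¹ := by group
  rw [h1] at hxx'
  rw [hNd _ hn _ hn' hxx']

/-- Among three pairwise distinct elements of one right coset of `V`, one is neither an `x` with `x y₀ ∈ N` nor of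
the form `n y₀` with `n ∈ N ∖ {1}` (each of the two kinds occurs at most once in the coset). [folklore] -/
theorem exists_good_of_three (hNd : ∀ n ∈ N, ∀ n' ∈ N, n * n'⁻¹ ∈ V → n = n') {x₁ x₂ x₃ : G}
    (h12 : x₁ * x₂⁻¹ ∈ V) (h13 : x₁ * x₃⁻¹ ∈ V) (h23 : x₂ * x₃⁻¹ ∈ V) (hne12 : x₁ ≠ x₂) (hne13 : x₁ ≠ x₃)
    (hne23 : x₂ ≠ x₃) :
    ∃ x : G, (x = x₁ ∨ x = x₂ ∨ x = x₃) ∧ x * y₀ ∉ N ∧ ∀ n ∈ N, n ≠ 1 → n * y₀ ≠ x := by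
  by_contra hcon
  push Not at hcon
  -- each candidate is bad in one of the two ways
  have hbad : ∀ x : G, (x = x₁ ∨ x = x₂ ∨ x = x₃) →
      x * y₀ ∈ N ∨ ∃ n ∈ N, n ≠ 1 ∧ n * y₀ = x := by
    intro x hx
    by_cases hP : x * y₀ ∈ N
    · exact Or.inl hP
    · obtain ⟨n, hn, hn1, hnx⟩ := hcon x hx hP
      exact Or.inr ⟨n, hn, hn1, hnx⟩
  have hP : ∀ {x x' : G}, x * x'⁻¹ ∈ V → x * y₀ ∈ N → x' * y₀ ∈ N → x = x' :=
    fun hxx' hx hx' => eq_of_mul_mem_of_mul_mem hNd hxx' hx hx'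
  have hQ : ∀ {x x' : G}, x * x'⁻¹ ∈ V → (∃ n ∈ N, n ≠ 1 ∧ n * y₀ = x) → (∃ n ∈ N, n ≠ 1 ∧ n * y₀ = x') →
      x = x' := by
    rintro x x' hxx' ⟨n, hn, -, hnx⟩ ⟨n', hn', -, hnx'⟩
    exact eq_of_eq_mul_of_eq_mul hNd hxx' hn hn' hnx hnx'
  rcases hbad x₁ (Or.inl rfl) with h1 | h1 <;> rcases hbad x₂ (Or.inr (Or.inl rfl)) with h2 | h2 <;>
    rcases hbad x₃ (Or.inr (Or.inr rfl)) with h3 | h3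
  · exact hne12 (hP h12 h1 h2)
  · exact hne12 (hP h12 h1 h2)
  · exact hne13 (hP h13 h1 h3)
  · exact hne23 (hQ h23 h2 h3)
  · exact hne23 (hP h23 h2 h3)
  · exact hne13 (hQ h13 h1 h3)
  · exact hne12 (hQ h12 h1 h2)
  · exact hne12 (hQ h12 h1 h2)

/-- **The extension step.**  `V ≤ H`, `a ≠ b` in `V ∖ {1}`, `y₀ ≠ 1`; `N ⊆ H` meets every right coset of `V` at most
once and satisfies `n ∈ N, n ≠ 1 ⟹ n y₀ ∉ N`.  If the coset `V z` (`z ∈ H`) misses `N`, then for some `x ∈ V z`,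
`x ∉ N`, the set `N ∪ {x}` has the same three properties. [folklore] -/
theorem exists_insert_of_forall_not_mem (hVH : V ≤ H) {a b : G} (ha : a ∈ V) (hb : b ∈ V) (ha1 : a ≠ 1)
    (hb1 : b ≠ 1) (hab : a ≠ b) (hy₀ : y₀ ≠ 1) (hNH : ∀ n ∈ N, n ∈ H)
    (hNd : ∀ n ∈ N, ∀ n' ∈ N, n * n'⁻¹ ∈ V → n = n') (hNe : ∀ n ∈ N, n ≠ 1 → n * y₀ ∉ N) {z : G}
    (hz : z ∈ H) (hzN : ∀ n ∈ N, n * z⁻¹ ∉ V) :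
    ∃ x : G, x * z⁻¹ ∈ V ∧ x ∉ N ∧ (∀ n ∈ insert x N, n ∈ H) ∧
      (∀ n ∈ insert x N, ∀ n' ∈ insert x N, n * n'⁻¹ ∈ V → n = n') ∧
      (∀ n ∈ insert x N, n ≠ 1 → n * y₀ ∉ insert x N) := by
  -- three pairwise distinct elements of `V z`
  have h12 : z * (a * z)⁻¹ ∈ V := by
    have : z * (a * z)⁻¹ = a⁻¹ := by group
    rw [this]; exact V.inv_mem ha
  have h13 : z * (b * z)⁻¹ ∈ V := by
    have : z * (b * z)⁻¹ = b⁻¹ := by group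
    rw [this]; exact V.inv_mem hb
  have h23 : a * z * (b * z)⁻¹ ∈ V := by
    have : a * z * (b * z)⁻¹ = a * b⁻¹ := by group
    rw [this]; exact V.mul_mem ha (V.inv_mem hb)
  have hne12 : z ≠ a * z := fun h => ha1 (mul_right_cancel (a := a) (b := z) (c := 1) (by rw [one_mul]; exact h.symm))
  have hne13 : z ≠ b * z := fun h => hb1 (mul_right_cancel (a := b) (b := z) (c := 1) (by rw [one_mul]; exact h.symm))
  have hne23 : a * z ≠ b * z := fun h => hab (mul_right_cancel h)
  obtain ⟨x, hx3, hxP, hxQ⟩ := exists_good_of_three hNd h12 h13 h23 hne12 hne13 hne23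
  -- `x ∈ V z`
  have hxz : x * z⁻¹ ∈ V := by
    rcases hx3 with rfl | rfl | rfl
    · rw [mul_inv_cancel]; exact V.one_mem
    · rw [mul_assoc, mul_inv_cancel, mul_one]; exact ha
    · rw [mul_assoc, mul_inv_cancel, mul_one]; exact hb
  have hxH : x ∈ H := by
    have : x = x * z⁻¹ * z := by group
    rw [this]; exact H.mul_mem (hVH hxz) hz
  have hxN : x ∉ N := fun h => hzN x h hxz
  -- anything of `N` in the coset of `x` would meet `V z`
  have hsame : ∀ n ∈ N, n * x⁻¹ ∈ V → False := by
    intro n hn hnx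
    apply hzN n hn
    have : n * z⁻¹ = n * x⁻¹ * (x * z⁻¹) := by group
    rw [this]; exact V.mul_mem hnx hxz
  refine ⟨x, hxz, hxN, ?_, ?_, ?_⟩
  · intro n hn
    rcases Finset.mem_insert.1 hn with rfl | hn
    · exact hxH
    · exact hNH n hn
  · intro n hn n' hn' hnn'
    obtain hnx | hnN := Finset.mem_insert.1 hn <;> obtain hn'x | hn'N := Finset.mem_insert.1 hn'
    · rw [hnx, hn'x]
    · subst hnx
      exact (hsame n' hn'N (by
        have : n' * n⁻¹ = (n * n'⁻¹)⁻¹ := by group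
        rw [this]; exact V.inv_mem hnn')).elim
    · subst hn'x
      exact (hsame n hnN hnn').elim
    · exact hNd n hnN n' hn'N hnn'
  · intro n hn hn1 hmem
    obtain hnx | hnN := Finset.mem_insert.1 hn
    · -- `n = x`: `x y₀ = x` is impossible, `x y₀ ∈ N` is excluded
      subst hnx
      obtain h | h := Finset.mem_insert.1 hmem
      · exact hy₀ (mul_left_cancel (a := n) (b := y₀) (c := 1) (by rw [mul_one]; exact h))
      · exact hxP h
    · obtain h | h := Finset.mem_insert.1 hmem
      · exact hxQ n hnN hn1 h
      · exact hNe n hnN hn1 h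

end Step

/-! ## §2 A right transversal containing `1` and `y₀` and avoiding its `y₀`-translate; trivial left stabiliser -/

section Transversal

variable [Fintype G] {V H : Subgroup G} {y₀ : G}

/-- **A right transversal of `V` in `H` with trivial left stabiliser.**  `V ≤ H`, `a ≠ b` in `V ∖ {1}`,
`y₀ ∈ H ∖ V` with `y₀² ≠ 1`.  Then there is `N ⊆ H` with `1 ∈ N`, `y₀ ∈ N`, meeting every right coset `V z`
(`z ∈ H`) exactly once, with `n y₀ ∉ N` for `n ∈ N ∖ {1}` — a maximal admissible partial transversal, which is full
by the extension step `exists_insert_of_forall_not_mem`. [folklore] -/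
theorem exists_transversal_avoiding (hVH : V ≤ H) {a b : G} (ha : a ∈ V) (hb : b ∈ V) (ha1 : a ≠ 1) (hb1 : b ≠ 1)
    (hab : a ≠ b) (hy₀H : y₀ ∈ H) (hy₀V : y₀ ∉ V) (hy₀2 : y₀ * y₀ ≠ 1) :
    ∃ N : Finset G, (∀ n ∈ N, n ∈ H) ∧ 1 ∈ N ∧ y₀ ∈ N ∧
      (∀ n ∈ N, ∀ n' ∈ N, n * n'⁻¹ ∈ V → n = n') ∧ (∀ z ∈ H, ∃ n ∈ N, n * z⁻¹ ∈ V) ∧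
      (∀ n ∈ N, n ≠ 1 → n * y₀ ∉ N) := by
  have hy₀1 : y₀ ≠ 1 := fun h => hy₀V (h ▸ V.one_mem)
  -- admissible sets
  set 𝒜 : Finset (Finset G) := Finset.univ.filter fun N => (∀ n ∈ N, n ∈ H) ∧ 1 ∈ N ∧ y₀ ∈ N ∧
      (∀ n ∈ N, ∀ n' ∈ N, n * n'⁻¹ ∈ V → n = n') ∧ (∀ n ∈ N, n ≠ 1 → n * y₀ ∉ N) with h𝒜_def
  have hmem𝒜 : ∀ N : Finset G, N ∈ 𝒜 ↔ (∀ n ∈ N, n ∈ H) ∧ 1 ∈ N ∧ y₀ ∈ N ∧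
      (∀ n ∈ N, ∀ n' ∈ N, n * n'⁻¹ ∈ V → n = n') ∧ (∀ n ∈ N, n ≠ 1 → n * y₀ ∉ N) := fun N => by
    rw [h𝒜_def, Finset.mem_filter]
    simp only [Finset.mem_univ, true_and]
  -- `{1, y₀}` is admissible
  have h0 : ({1, y₀} : Finset G) ∈ 𝒜 := by
    rw [hmem𝒜]
    refine ⟨?_, by simp, by simp, ?_, ?_⟩
    · intro n hn
      rcases Finset.mem_insert.1 hn with rfl | hn
      · exact H.one_mem
      · rw [Finset.mem_singleton] at hn; rw [hn]; exact hy₀H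
    · intro n hn n' hn' hnn'
      simp only [Finset.mem_insert, Finset.mem_singleton] at hn hn'
      obtain rfl | rfl := hn <;> obtain rfl | rfl := hn'
      · rfl
      · exact (hy₀V (by rw [one_mul] at hnn'; exact (V.inv_mem_iff).1 hnn')).elim
      · exact (hy₀V (by rw [inv_one, mul_one] at hnn'; exact hnn')).elim
      · rfl
    · intro n hn hn1 hmem
      simp only [Finset.mem_insert, Finset.mem_singleton] at hn hmem
      obtain rfl | rfl := hn
      · exact hn1 rfl
      · obtain h | h := hmem
        · exact hy₀2 h
        · exact hy₀1 (mul_left_cancel (a := n) (b := n) (c := 1) (by rw [mul_one]; exact h))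
  -- a maximal admissible set
  obtain ⟨N, hN𝒜, hmax⟩ := Finset.exists_max_image 𝒜 Finset.card ⟨_, h0⟩
  obtain ⟨hNH, hN1, hNy, hNd, hNe⟩ := (hmem𝒜 N).1 hN𝒜
  refine ⟨N, hNH, hN1, hNy, hNd, ?_, hNe⟩
  -- it is full
  intro z hz
  by_contra hzN
  push Not at hzN
  obtain ⟨x, -, hxN, hH', hd', he'⟩ :=
    exists_insert_of_forall_not_mem hVH ha hb ha1 hb1 hab hy₀1 hNH hNd hNe hz hzN
  have hins : insert x N ∈ 𝒜 := by
    rw [hmem𝒜]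
    exact ⟨hH', Finset.mem_insert_of_mem hN1, Finset.mem_insert_of_mem hNy, hd', he'⟩
  have hle := hmax _ hins
  rw [Finset.card_insert_of_notMem hxN] at hle
  omega

omit [Fintype G] in
/-- **Trivial left stabiliser**: if `1, y₀ ∈ N` and `n y₀ ∉ N` for all `n ∈ N ∖ {1}`, then `u N ⊆ N` forces `u = 1`
(`u = u·1 ∈ N` and `u·y₀ ∈ N`).  For a CM set built on `N` this is primitivity of the CM type
(Shimura's criterion). [cite: Shimura1998, §8.2 Prop. 26] -/
theorem eq_one_of_forall_mul_mem {N : Finset G} (hN1 : 1 ∈ N) (hNy : y₀ ∈ N)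
    (hNe : ∀ n ∈ N, n ≠ 1 → n * y₀ ∉ N) {u : G} (hu : ∀ n ∈ N, u * n ∈ N) : u = 1 := by
  by_contra hu1
  have h1 : u ∈ N := by simpa using hu 1 hN1
  exact hNe u h1 hu1 (hu y₀ hNy)

/-- Three elements from `3 ≤ |V|`: a subgroup with at least three elements contains `a ≠ b`, both `≠ 1`. [folklore] -/
theorem exists_pair_of_three_le_card (h3 : 3 ≤ Nat.card V) : ∃ a ∈ V, ∃ b ∈ V, a ≠ 1 ∧ b ≠ 1 ∧ a ≠ b := by
  have hcard : (Finset.univ.filter fun g : G => g ∈ V).card = Nat.card V := by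
    rw [Nat.card_eq_fintype_card, ← Fintype.card_subtype]
  have h2 : 2 < (Finset.univ.filter fun g : G => g ∈ V).card := by rw [hcard]; omega
  obtain ⟨p, q, r, hp, hq, hr, hpq, hpr, hqr⟩ := Finset.two_lt_card_iff.1 h2
  simp only [Finset.mem_filter, Finset.mem_univ, true_and] at hp hq hr
  by_cases hp1 : p = 1
  · subst hp1
    exact ⟨q, hq, r, hr, fun h => hpq h.symm, fun h => hpr h.symm, hqr⟩
  · by_cases hq1 : q = 1
    · subst hq1
      exact ⟨p, hp, r, hr, hp1, fun h => hqr h.symm, hpr⟩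
    · exact ⟨p, hp, q, hq, hp1, hq1, hpq⟩

/-- **Packaged form.**  `V ≤ H` with `3 ≤ |V|`, `y₀ ∈ H ∖ V` with `y₀² ≠ 1`: a right transversal `N ∋ 1` of `V` in
`H` (exactly one `v ∈ V` with `v y ∈ N` for every `y ∈ H`) whose left stabiliser is trivial. [folklore] -/
theorem exists_transversal (hVH : V ≤ H) (h3 : 3 ≤ Nat.card V) (hy₀H : y₀ ∈ H) (hy₀V : y₀ ∉ V)
    (hy₀2 : y₀ * y₀ ≠ 1) :
    ∃ N : Finset G, (∀ n ∈ N, n ∈ H) ∧ 1 ∈ N ∧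
      (∀ y ∈ H, ∃ v ∈ V, v * y ∈ N ∧ ∀ v' ∈ V, v' * y ∈ N → v' = v) ∧
      (∀ u : G, (∀ n ∈ N, u * n ∈ N) → u = 1) := by
  obtain ⟨a, ha, b, hb, ha1, hb1, hab⟩ := exists_pair_of_three_le_card h3
  obtain ⟨N, hNH, hN1, hNy, hNd, hNf, hNe⟩ := exists_transversal_avoiding hVH ha hb ha1 hb1 hab hy₀H hy₀V hy₀2
  refine ⟨N, hNH, hN1, fun y hy => ?_, fun u hu => eq_one_of_forall_mul_mem hN1 hNy hNe hu⟩
  obtain ⟨n, hn, hny⟩ := hNf y hy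
  refine ⟨n * y⁻¹, hny, by rw [inv_mul_cancel_right]; exact hn, fun v' hv' hv'y => ?_⟩
  have h := hNd _ hv'y _ hn (by
    have : v' * y * n⁻¹ = v' * (n * y⁻¹)⁻¹ := by group
    rw [this]; exact V.mul_mem hv' (V.inv_mem hny))
  rw [← h, mul_inv_cancel_right]

/-! ## §3 Counting: `|N| · |V| = |H|` -/

/-- **`|N| · |V| = |H|`** for a right transversal `N ⊆ H` of `V ≤ H` (double counting the pairs `(v, y) ∈ V × H`
with `v y ∈ N`: one `v` for each `y`, and `|N|` values of `y` for each `v`). [folklore] -/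
theorem card_mul_card_eq (hVH : V ≤ H) {N : Finset G} (hNH : ∀ n ∈ N, n ∈ H)
    (hT : ∀ y ∈ H, ∃ v ∈ V, v * y ∈ N ∧ ∀ v' ∈ V, v' * y ∈ N → v' = v) :
    N.card * Nat.card V = Nat.card H := by
  set HF : Finset G := Finset.univ.filter fun g => g ∈ H with hHF
  set VF : Finset G := Finset.univ.filter fun g => g ∈ V with hVF
  have hHFc : HF.card = Nat.card H := by rw [hHF, Nat.card_eq_fintype_card, ← Fintype.card_subtype]
  have hVFc : VF.card = Nat.card V := by rw [hVF, Nat.card_eq_fintype_card, ← Fintype.card_subtype]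
  have hmemH : ∀ g, g ∈ HF ↔ g ∈ H := fun g => by rw [hHF, Finset.mem_filter]; simp
  have hmemV : ∀ g, g ∈ VF ↔ g ∈ V := fun g => by rw [hVF, Finset.mem_filter]; simp
  -- for each `y ∈ H` exactly one `v ∈ V` with `v y ∈ N`
  have hrow : ∀ y ∈ HF, (VF.filter fun v => v * y ∈ N).card = 1 := by
    intro y hy
    obtain ⟨v, hv, hvy, huniq⟩ := hT y ((hmemH y).1 hy)
    rw [Finset.card_eq_one]
    refine ⟨v, Finset.ext fun v' => ?_⟩
    rw [Finset.mem_filter, Finset.mem_singleton, hmemV]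
    constructor
    · rintro ⟨hv', hv'y⟩; exact huniq v' hv' hv'y
    · rintro rfl; exact ⟨hv, hvy⟩
  -- for each `v ∈ V` exactly `|N|` values `y ∈ H` with `v y ∈ N`
  have hcol : ∀ v ∈ VF, (HF.filter fun y => v * y ∈ N).card = N.card := by
    intro v hv
    have hvH : v ∈ H := hVH ((hmemV v).1 hv)
    have himg : (HF.filter fun y => v * y ∈ N).image (fun y => v * y) = N := by
      ext n
      rw [Finset.mem_image]
      constructor
      · rintro ⟨y, hy, rfl⟩
        exact (Finset.mem_filter.1 hy).2
      · intro hn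
        refine ⟨v⁻¹ * n, Finset.mem_filter.2 ⟨(hmemH _).2 (H.mul_mem (H.inv_mem hvH) (hNH n hn)), ?_⟩, ?_⟩
        · rw [mul_inv_cancel_left]; exact hn
        · rw [mul_inv_cancel_left]
    rw [← Finset.card_image_of_injective (HF.filter fun y => v * y ∈ N) (mul_right_injective v), himg]
  -- double count
  have hsum : ∑ y ∈ HF, (VF.filter fun v => v * y ∈ N).card = ∑ v ∈ VF, (HF.filter fun y => v * y ∈ N).card := by
    simp_rw [Finset.card_filter]
    exact Finset.sum_comm
  rw [Finset.sum_congr rfl hrow, Finset.sum_congr rfl hcol, Finset.sum_const, Finset.sum_const, smul_eq_mul,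
    smul_eq_mul, mul_one] at hsum
  rw [← hHFc, ← hVFc, hsum, mul_comm]

end Transversal

end Summit.HodgeConjecture.CorCM.TwiceOdd
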